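import Summits.ResolutionOfSingularities.ResolutionOfSingularities.Theorems.TameAbelianQuotientLU
import Literature.AlgebraicGeometry.Resolution.LocAtCentreSubfieldTransport
import HarnessLib

/-!
# TameAbelianQuotientLU (2/5) — the abelian model brick

Part 2 of the g26 node `TameAbelianQuotientLU` of the ROOT/RESIDUAL decomposition cell
`decomp-res` (lens 1, window (W-ab) of critic row 193); see the module docstring of
`Summits.ResolutionOfSingularities.ResolutionOfSingularities.Theorems.TameAbelianQuotientLU` (part 1/5) for the thesis, the law,
the residual R26, the cuts and the sources.  Problem side, sorry-free, hypothesis-free.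

This part: `exists_jointly_fixed_model_isRegularLocalRing` — a `G`-stable regular model above
descends through a whole COMMUTING tame family at once to a JOINTLY FIXED regular model
([CoP1] Prop. 6.2 (2) + Lemma 9.4, abelian/Kummer case, model currency).
-/

noncomputable section

open IntermediateField Polynomial Literature.AlgebraicGeometry.Resolution IsLocalRing

namespace Summit.ResolutionOfSingularities.ResolutionOfSingularities.Theorems.TameAbelianQuotientLU

/-! ## Part A2 — the abelian model brick (abelian analogue of
`TameCyclicToricDescentModels.exists_fixed_model_isRegularLocalRing`; Literature-shaped) -/

section Brick

variable {F : Type} [Field F] (O : ValuationSubring F)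

-- [WRITER NOTE (decomp-res writer g13)] the lens's `locAtCentre_closure_locAtCentre_union` (Novacoski–Spivakovsky, Lemma 2.9) restated the
-- landed `Literature.AlgebraicGeometry.Resolution.locAtCentre_closure_locAtCentre_union_eq` [LocAtCentreSubfieldTransport] VERBATIM (gate pre-flight
-- `dedup.landed`); deleted here, the module imported, its one use below rewritten to the landed name.

/-- `closure (closure X ∪ Y) = closure (X ∪ Y)`. [folklore] -/
theorem closure_closure_union (X Y : Set F) :
    Subring.closure ((Subring.closure X : Set F) ∪ Y) = Subring.closure (X ∪ Y) := by
  apply le_antisymm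
  · refine Subring.closure_le.mpr (Set.union_subset ?_ ?_)
    · exact Subring.closure_mono Set.subset_union_left
    · exact fun y hy => Subring.subset_closure (Or.inr hy)
  · refine Subring.closure_mono ?_
    rintro x (hx | hx)
    · exact Or.inl (Subring.subset_closure hx)
    · exact Or.inr hx

/-- Restriction of a ring automorphism of `F` to a stable subring. -/
def restrictAut (τ : F ≃+* F) (B : Subring F) (h : ∀ b ∈ B, τ b ∈ B)
    (h' : ∀ b ∈ B, τ.symm b ∈ B) : B ≃+* B :=
  { toFun := fun b => ⟨τ b, h b b.2⟩
    invFun := fun b => ⟨τ.symm b, h' b b.2⟩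
    left_inv := fun b => Subtype.ext (τ.symm_apply_apply (b : F))
    right_inv := fun b => Subtype.ext (τ.apply_symm_apply (b : F))
    map_mul' := fun a b => Subtype.ext (map_mul τ (a : F) (b : F))
    map_add' := fun a b => Subtype.ext (map_add τ (a : F) (b : F)) }

/-- `restrictAut_apply`: Auxiliary step of this node's calculus, VERBATIM from the lens file (see the module
docstring); the statement is its type. [folklore] -/
theorem restrictAut_apply (τ : F ≃+* F) (B : Subring F) (h : ∀ b ∈ B, τ b ∈ B)
    (h' : ∀ b ∈ B, τ.symm b ∈ B) (b : B) : ((restrictAut τ B h h' b : B) : F) = τ b := rfl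

/-- **The abelian toric descent step for models** (the inheritance point of window (W-ab),
PROVED): let `τ₀, …, τ_{r-1}` be pairwise COMMUTING automorphisms of a field `F` with
`τᵢ^ℓ = 1` and `τᵢ O ⊆ O` for a valuation ring `O` of `F`; `S ⊆ F` a universally catenary
subring fixed pointwise by every `τᵢ`, containing `ℓ⁻¹` and an `ℓ`-th root of unity `ζ` with
`ζ^k - 1 ∈ S^×` (`0 < k < ℓ`); `S[t₀] ⊆ O` a finitely generated model STABLE under every `τᵢ`
whose local ring `B` at the centre of `O` is REGULAR of dimension `d`, every `τᵢ` residually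
trivial on `B`, and the residue field of `O` algebraic over that of `S`.  Then there is a finite
set `t ⊆ O` of JOINTLY FIXED elements such that the local ring of the model `S[t]` at the centre
of `O` is regular.  Proof: joint eigen-parameters of the commuting family on `B`
([CoP1] Prop. 6.2 (2) (28)–(30), `exists_joint_eigen_regularParameters_of_commuting`); the ring
of joint invariants `A = B ∩ F^G` is the local ring of the jointly fixed model `S[t₀]^G = S[G₁]`
(`locAtCentre_inf_jointFixedSubring_eq`, `exists_finset_closure_eq_inf_jointFixedSubring`),
hence universally catenary; the jointly fixed toric chart over `A`
(`exists_fixed_toricChart_of_commuting_isRegularLocalRing`, [CoP1] Lemma 9.4). (Sources: CossartPiltant2008, Prop.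
6.2 (2) and proof of Lemma 9.4 (HAL pp. 19, 28–29); CossartPiltant2019, Section 4.1 (LU) and proof of Prop. 4.10.) -/
theorem exists_jointly_fixed_model_isRegularLocalRing (τ : ℕ → F ≃+* F) (r : ℕ)
    (hτO : ∀ i < r, ∀ x ∈ O, τ i x ∈ O)
    (S : Subring F) (hτS : ∀ i < r, ∀ s ∈ S, τ i s = s) (hSuc : IsUniversallyCatenaryRing S)
    (t₀ : Finset F) (hT₀O : Subring.closure ((S : Set F) ∪ ↑t₀) ≤ O.toSubring)
    (hτT₀ : ∀ i < r, ∀ x ∈ Subring.closure ((S : Set F) ∪ ↑t₀),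
      τ i x ∈ Subring.closure ((S : Set F) ∪ ↑t₀))
    (hBreg : IsRegularLocalRing (locAtCentre (Subring.closure ((S : Set F) ∪ ↑t₀)) O)) {d : ℕ}
    (hBdim : ringKrullDim (locAtCentre (Subring.closure ((S : Set F) ∪ ↑t₀)) O) = d)
    (hres : ∀ i < r, ∀ b ∈ locAtCentre (Subring.closure ((S : Set F) ∪ ↑t₀)) O,
      O.valuation (τ i b - b) < 1)
    (halg : ∀ z : O, ∃ q : Polynomial S, (∃ i, IsUnit (q.coeff i)) ∧
      O.valuation (Polynomial.aeval (z : F) q) < 1)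
    {ℓ : ℕ} (hℓ0 : ℓ ≠ 0) (hτℓ : ∀ i < r, τ i ^ ℓ = 1)
    (hcomm : ∀ i < r, ∀ i' < r, ∀ z : F, τ i (τ i' z) = τ i' (τ i z))
    (hℓu : IsUnit ((ℓ : S)))
    (ζ : F) (hζS : ζ ∈ S) (hζℓ : ζ ^ ℓ = 1)
    (hζu : ∀ k : ℕ, 0 < k → k < ℓ → IsUnit ((⟨ζ, hζS⟩ : S) ^ k - 1)) :
    ∃ t : Finset F, (∀ i < r, ∀ z ∈ t, τ i z = z) ∧
      Subring.closure ((S : Set F) ∪ ↑t) ≤ O.toSubring ∧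
      IsRegularLocalRing (locAtCentre (Subring.closure ((S : Set F) ∪ ↑t)) O) := by
  classical
  -- the jointly fixed model `S[t₀]^G = S[G₁]` (Part A1), before `T₀` is abbreviated
  obtain ⟨G₁, hG₁fix, hG₁T₀, hT₁eq⟩ := exists_finset_closure_eq_inf_jointFixedSubring τ r hℓ0
    hτℓ hcomm S hSuc.1 hτS t₀ hτT₀
  have hAeqr := locAtCentre_inf_jointFixedSubring_eq τ r hℓ0 hτℓ hcomm O hτO _ hτT₀
  set T₀ := Subring.closure ((S : Set F) ∪ ↑t₀) with hT₀
  set B := locAtCentre T₀ O with hB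
  have hBO : B ≤ O.toSubring := locAtCentre_le hT₀O
  have hST₀ : S ≤ T₀ := fun s hs => Subring.subset_closure (Or.inl hs)
  have hT₀B : T₀ ≤ B := le_locAtCentre T₀ O
  have hSB : S ≤ B := hST₀.trans hT₀B
  have hℓpos : 0 < ℓ := Nat.pos_of_ne_zero hℓ0
  haveI := hBreg
  have hτζ : ∀ i < r, τ i ζ = ζ := fun i hi => hτS i hi ζ hζS
  -- `(τ i)⁻¹ = (τ i)^(ℓ-1)`
  have hτsymm : ∀ i < r, ∀ b : F, (τ i).symm b = (τ i ^ (ℓ - 1)) b := fun i hi b => by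
    rw [RingEquiv.symm_apply_eq]
    change b = (τ i * τ i ^ (ℓ - 1)) b
    rw [← pow_succ', Nat.sub_add_cancel hℓpos, hτℓ i hi]
    rfl
  -- units of `O` stay units of `O`
  have hτunit : ∀ i < r, ∀ s ∈ O, O.valuation s = 1 → O.valuation (τ i s) = 1 := by
    intro i hi s hs hs1
    have hs0 : s ≠ 0 := ne_zero_of_valuation_eq_one hs1
    refine le_antisymm ((O.valuation_le_one_iff _).mpr (hτO i hi _ hs)) ?_
    have hsinv : s⁻¹ ∈ O := by rw [← O.valuation_le_one_iff, map_inv₀, hs1, inv_one]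
    have h := (O.valuation_le_one_iff _).mpr (hτO i hi _ hsinv)
    rw [map_inv₀, map_inv₀, inv_le_one₀ ((Valuation.pos_iff _).mpr
      (fun e => hs0 (by simpa using congrArg (τ i).symm e)))] at h
    exact h
  -- `B` is stable under every `τ i` and its inverse
  have hτB : ∀ i < r, ∀ b ∈ B, τ i b ∈ B := by
    intro i hi b hb
    obtain ⟨y, hy, s, hs, hsv, rfl⟩ := mem_locAtCentre_iff.mp hb
    exact mem_locAtCentre_iff.mpr ⟨τ i y, hτT₀ i hi y hy, τ i s, hτT₀ i hi s hs,
      hτunit i hi s (hT₀O hs) hsv, map_div₀ (τ i) y s⟩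
  have hτpowB : ∀ i < r, ∀ (k : ℕ) (b : F), b ∈ B → (τ i ^ k) b ∈ B := by
    intro i hi k
    induction k with
    | zero => intro b hb; exact hb
    | succ k ih => intro b hb; rw [pow_succ', RingAut.mul_apply]; exact hτB i hi _ (ih b hb)
  have hτB' : ∀ i < r, ∀ b ∈ B, (τ i).symm b ∈ B := fun i hi b hb => by
    rw [hτsymm i hi]; exact hτpowB i hi _ b hb
  have hdomB : ∀ b : B, b ∈ maximalIdeal B ↔ O.valuation (b : F) < 1 :=
    mem_maximalIdeal_locAtCentre_iff hT₀O
  -- the ring of joint invariants `A = B ∩ F^G = (S[G₁])_𝔪` is universally catenary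
  let A : Subring F := B ⊓ jointFixedSubring τ r
  have hA : ∀ b, b ∈ A ↔ b ∈ B ∧ ∀ i < r, τ i b = b := fun b => by
    rw [Subring.mem_inf, mem_jointFixedSubring]
  have hT₁O : Subring.closure ((S : Set F) ∪ ↑G₁) ≤ O.toSubring := by
    rw [← hT₁eq]; exact fun x hx => hT₀O hx.1
  have hAuc : IsUniversallyCatenaryRing A := by
    change IsUniversallyCatenaryRing ↥(B ⊓ jointFixedSubring τ r)
    rw [hB, hAeqr, hT₁eq]
    exact isUniversallyCatenaryRing_locAtCentre_closure O S hSuc G₁ hT₁O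
  -- hypotheses of the descent step on `B`
  have hℓuB : IsUnit ((ℓ : B)) := by
    have h := hℓu.map (Subring.inclusion hSB)
    rwa [map_natCast] at h
  have hζB : ζ ∈ B := hSB hζS
  have hζuB : ∀ k : ℕ, 0 < k → k < ℓ → IsUnit ((⟨ζ, hζB⟩ : B) ^ k - 1) := by
    intro k hk hkℓ
    have h := (hζu k hk hkℓ).map (Subring.inclusion hSB)
    rw [map_sub, map_pow, map_one] at h
    exact h
  have hSA : S ≤ A := fun s hs => (hA s).mpr ⟨hSB hs, fun i hi => hτS i hi s hs⟩
  have halgA : ∀ z : O, ∃ q : Polynomial A, (∃ i, IsUnit (q.coeff i)) ∧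
      O.valuation (Polynomial.aeval (z : F) q) < 1 := by
    intro z
    obtain ⟨q, ⟨i, hi⟩, hqz⟩ := halg z
    refine ⟨q.map (Subring.inclusion hSA), ⟨i, ?_⟩, ?_⟩
    · rw [Polynomial.coeff_map]; exact hi.map _
    · rw [Polynomial.aeval_def, Polynomial.eval₂_map]
      rw [Polynomial.aeval_def] at hqz
      exact hqz
  -- the `τ i` restricted to `B`
  let τB : ℕ → B ≃+* B := fun i =>
    if hi : i < r then restrictAut (τ i) B (hτB i hi) (hτB' i hi) else RingEquiv.refl B
  have hτB_apply : ∀ i < r, ∀ b : B, ((τB i b : B) : F) = τ i b := fun i hi b => by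
    simp only [τB, dif_pos hi, restrictAut_apply]
  have hτBpow : ∀ i < r, ∀ (k : ℕ) (b : B), (((τB i ^ k) b : B) : F) = (τ i ^ k) (b : F) := by
    intro i hi k
    induction k with
    | zero => intro b; rfl
    | succ k ih =>
      intro b; rw [pow_succ', RingAut.mul_apply, pow_succ', RingAut.mul_apply, hτB_apply i hi, ih]
  have hτBℓ : ∀ i < r, τB i ^ ℓ = 1 := fun i hi =>
    RingEquiv.ext fun b => Subtype.ext (by rw [hτBpow i hi, hτℓ i hi]; rfl)
  have hcommB : ∀ i < r, ∀ i' < r, ∀ b : B, τB i (τB i' b) = τB i' (τB i b) := by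
    intro i hi i' hi' b
    apply Subtype.ext
    simp only [hτB_apply i hi, hτB_apply i' hi']
    exact hcomm i hi i' hi' _
  let ζB : B := ⟨ζ, hζB⟩
  have hτζB : ∀ i < r, τB i ζB = ζB := fun i hi =>
    Subtype.ext (by rw [hτB_apply i hi]; exact hτζ i hi)
  have hζBℓ : ζB ^ ℓ = 1 := Subtype.ext (by
    change ((ζB ^ ℓ : B) : F) = 1
    rw [SubmonoidClass.coe_pow]; exact hζℓ)
  -- joint eigen-parameters ([CoP1] Prop. 6.2 (2) (28)–(30))
  obtain ⟨x, s, hspan, hsx⟩ :=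
    exists_joint_eigen_regularParameters_of_commuting τB r hℓ0 hτBℓ hcommB hℓuB ζB hτζB hζBℓ
      hζuB hBdim
  let xF : Fin d → F := fun j => ((x j : B) : F)
  have hxB : ∀ j, xF j ∈ B := fun j => (x j).2
  have hspanF : Ideal.span (Set.range fun j => (⟨xF j, hxB j⟩ : B)) = maximalIdeal B := by
    have : (fun j => (⟨xF j, hxB j⟩ : B)) = x := funext fun j => Subtype.ext rfl
    rw [this]; exact hspan
  have hτx : ∀ i < r, ∀ j, τ i (xF j) = ζ ^ s i j * xF j := fun i hi j => by
    have h := congrArg (fun b : B => (b : F)) (hsx i hi j).2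
    simpa [hτB_apply i hi, xF] using h
  -- the parameters are non-zero: `𝔪_B` needs `d = dim B` generators
  have hx0 : ∀ j, xF j ≠ 0 := by
    intro j₀ h0
    have hxj : x j₀ = 0 := Subtype.ext h0
    have hspan' : Ideal.span (((Finset.univ.erase j₀).image x : Finset B) : Set B) =
        maximalIdeal B := by
      rw [← hspan]
      apply le_antisymm
      · refine Ideal.span_mono ?_
        intro b hb
        obtain ⟨j, -, rfl⟩ := Finset.mem_image.mp (Finset.mem_coe.mp hb)
        exact ⟨j, rfl⟩
      · refine Ideal.span_le.mpr ?_
        rintro _ ⟨j, rfl⟩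
        by_cases hj : j = j₀
        · subst hj; rw [hxj]; exact Ideal.zero_mem _
        · exact Ideal.subset_span (Finset.mem_coe.mpr (Finset.mem_image.mpr
            ⟨j, Finset.mem_erase.mpr ⟨hj, Finset.mem_univ j⟩, rfl⟩))
    have h1 : ((maximalIdeal B).spanFinrank : WithBot ℕ∞) = ringKrullDim B :=
      IsRegularLocalRing.spanFinrank_maximalIdeal
    have h2 : (maximalIdeal B).spanFinrank ≤ d - 1 := by
      rw [← hspan']
      calc (Ideal.span (((Finset.univ.erase j₀).image x : Finset B) : Set B)).spanFinrank
          ≤ (((Finset.univ.erase j₀).image x : Finset B) : Set B).ncard :=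
            Submodule.spanFinrank_span_le_ncard_of_finite (Finset.finite_toSet _)
        _ = ((Finset.univ.erase j₀).image x).card := Set.ncard_coe_finset _
        _ ≤ (Finset.univ.erase j₀).card := Finset.card_image_le
        _ = d - 1 := by rw [Finset.card_erase_of_mem (Finset.mem_univ _), Finset.card_univ,
            Fintype.card_fin]
    rw [hBdim] at h1
    have h3 : (maximalIdeal B).spanFinrank = d := by exact_mod_cast h1
    have : 0 < d := Fin.pos j₀
    omega
  -- the jointly fixed toric chart over the ring of joint invariants ([CoP1] Lemma 9.4)
  obtain ⟨y, hτy, hyO, hreg⟩ :=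
    exists_fixed_toricChart_of_commuting_isRegularLocalRing O τ r hℓ0 hτℓ hcomm B hBO hdomB hτB
      hℓuB ζ hζB hτζ hζℓ hζuB hres hBdim xF hxB hx0 hspanF s hτx A hA hAuc halgA
  -- the model `S[G₁, y]`
  refine ⟨G₁ ∪ Finset.univ.image y, ?_, ?_, ?_⟩
  · intro i hi z hz
    rcases Finset.mem_union.mp hz with hz | hz
    · exact hG₁fix i hi z hz
    · obtain ⟨k, -, rfl⟩ := Finset.mem_image.mp hz
      exact hτy i hi k
  · refine Subring.closure_le.mpr (Set.union_subset (fun s hs => hBO (hSB hs)) ?_)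
    intro z hz
    rcases Finset.mem_union.mp (Finset.mem_coe.mp hz) with hz | hz
    · exact hT₀O (hG₁T₀ z hz)
    · obtain ⟨k, -, rfl⟩ := Finset.mem_image.mp hz
      exact hyO k
  · have hset : ((G₁ ∪ Finset.univ.image y : Finset F) : Set F) = (G₁ : Set F) ∪ Set.range y := by
      ext z
      simp only [Finset.coe_union, Set.mem_union, Finset.mem_coe, Finset.mem_image,
        Finset.mem_univ, true_and, Set.mem_range]
    have hkey : locAtCentre (Subring.closure ((A : Set F) ∪ Set.range y)) O =
        locAtCentre (Subring.closure ((S : Set F) ∪ ↑(G₁ ∪ Finset.univ.image y))) O := by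
      change locAtCentre (Subring.closure ((↑(B ⊓ jointFixedSubring τ r) : Set F) ∪ Set.range y)) O = _
      rw [hB, hAeqr, hT₁eq, locAtCentre_closure_locAtCentre_union_eq O, closure_closure_union, hset,
        Set.union_assoc]
    rw [← hkey]
    exact hreg

end Brick

end Summit.ResolutionOfSingularities.ResolutionOfSingularities.Theorems.TameAbelianQuotientLU

end
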